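import Summits.CriticalPhenomena.PercolationContinuityZ3.Theorems.Transplant.AutEndStateFC
import HarnessLib

/-!
# END-STATE CONTINUITY for orbit data with a VIRTUALLY INNER twist and a FINITE-CENTRE kernel: such data carry an FC element of non-trivial character,
# so `θ_x(p_c) = 0` everywhere by the covering route («AutEndStateFC» `AutCyl.conj4_of_orbitDatum_fc`) — UNCONDITIONAL, pure group theory on top of p567166

builds on p205010 (kernel theorem, internal audit signed; external expert review pending).  Lane `prim-bschramm`, seat `prim-bschramm-p3` gen 33 (DESIGN OWNER;
`P3-NILPOTENT.md` §25.4 = the refuter's algebraic remark, §26.3 = this file's offer, GO lead g24).  Helper file (`--supports stmt-CriticalPhenomena-4575 --as helper`).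
NOTHING is claimed about the `@[conjecture]` `BenjaminiSchramm1996_conj4_endState` itself (its residual class is NON-EMPTY, `P3-NILPOTENT.md` §26): this file
proves its conclusion under TWO extra hypotheses on the orbit datum `(A₀, reps, c)`, `K := ker c`:
* (VI) VIRTUALLY INNER TWIST — every `a ∈ A₀` has a power `aⁿ` (`n ≥ 1`) acting on `K` as an inner automorphism of `K`: `aⁿ k⁻¹` centralises `K` for some `k ∈ K`;
* (ZF) FINITE CENTRE — the set `{z ∈ K | z commutes with K}` is finite.
THEN (§2) there is `h ∈ A₀` with `c h ≠ 1` whose centraliser has finite index, i.e. the FC hypothesis of `conj4_of_orbitDatum_fc`, and (§3) `θ_x(p_c) = 0` at every `x`.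

PROOF (§1–§2, group theory only).  Pick the rank-two pair `a, b` and corrected lifts `h₁ = a^{n₁} k₁⁻¹`, `h₂ = b^{n₂} k₂⁻¹` centralising `K`.  The conjugates
`h₂^m h₁ h₂^{-m}` all lie in the FINITE set `Z(K) · h₁` (the cocycle `h₂^m h₁ h₂^{-m} h₁⁻¹` is killed by `c` — the target is commutative — and centralises `K`), so by
pigeonhole two of them agree and `h₂^M` commutes with `h₁` for some `M ≥ 1` (§1).  Then `u = c h₁`, `v = c h₂^M` are independent (`det = n₁ n₂ M · det(c a, c b) ≠ 0`),
and the kernel `N` of `A₀ → ℤ² → (ℤ/D)²` (`D = det(u, v)`; finite index as the kernel of a map to a finite group) centralises `h₁`: for `n ∈ N`, `c n ∈ D·ℤ² ⊆ ℤu + ℤv`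
by Cramer («SiteTwoMaxArea» `MaxArea.cramer`), so `n ∈ K · h₁^i · (h₂^M)^j`, each factor commuting with `h₁` (§2).
WHAT THE CRITERION RECOGNISES (refuter's located item W-Outer-1, p5-g30): (VI) + (ZF) + rank two give MORE than an FC witness — `H := K · ⟨h₁, h₂^M⟩` is an
internal direct product `K × ℤ²` of FINITE INDEX in `A₀` (`h₁, h₂^M` centralise `K`, commute by §1, and meet `K` trivially since `c h₁, c h₂^M` are independent).
So the class of data this file recognises is exactly the VIRTUALLY SPLIT one, `A₀ ⊇ K × ℤ²` of finite index with `K = ker c` — at the Cayley level inside gen-1's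
«AutEndStateFCCayley» row `conj4_cayley_of_virtually_prod_zd`, at the action level inside the virtual-FC rows of «AutEndStateFCAction»; what is NEW here is the
typed GROUP-THEORETIC TEST (Out-torsion twist + finite-centre kernel ⟹ virtually split ⟹ FC witness), WHATEVER THE GROWTH, not a new class of graphs.  It does
NOT reach the residual witness `ℤ² ≀_X 𝔊` of `P3-NILPOTENT.md` §26 (twist of infinite outer order ⟺ not virtually split there).  Instances are gen-1's (RULING W-2).
[cite: BenjaminiSchramm1996, Conj. 4; §2 (almost transitive graphs)] [cite: MartineauSevero2019, Cor. 2.2] [cite: Hutchcroft2016, Thm. 1.1]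
-/

noncomputable section

namespace Summit.CriticalPhenomena.PercolationContinuityZ3.Theorems.Transplant

namespace AutCyl

open SimpleGraph Literature.Barriers.CriticalPhenomena Literature.Probability.LatticeModels Literature.Probability.Percolation
open scoped Classical

/-! ## §1 Two lifts centralising the kernel commute up to a power when the kernel's centre is finite -/

/-- **Pigeonhole on the finite centre.**  Let `c : A →* B` with `B` commutative, and let `h₁, h₂ ∈ A` both commute with every element of `ker c`.  If the set
`{z | c z = 1 ∧ z commutes with ker c}` (the centre of the kernel) is finite, then `h₂^M` commutes with `h₁` for some `M ≥ 1`: the conjugates `h₂^m h₁ h₂^{-m}`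
lie in the finite set `Z(ker c) · h₁`, so two of them coincide. [folklore] -/
theorem exists_pow_commute_of_finite_center {A : Type} [Group A] {B : Type} [CommGroup B] (c : A →* B)
    (hZ : Set.Finite {z : A | c z = 1 ∧ ∀ k : A, c k = 1 → k * z = z * k})
    {h₁ h₂ : A} (hh₁ : ∀ k : A, c k = 1 → k * h₁ = h₁ * k) (hh₂ : ∀ k : A, c k = 1 → k * h₂ = h₂ * k) :
    ∃ M : ℕ, 1 ≤ M ∧ h₂ ^ M * h₁ = h₁ * h₂ ^ M := by
  -- the centraliser of the kernel, as a subgroup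
  set C : Subgroup A := Subgroup.centralizer (c.ker : Set A) with hC
  have memC : ∀ {g : A}, g ∈ C ↔ ∀ k : A, c k = 1 → k * g = g * k := fun {g} => by
    rw [hC, Subgroup.mem_centralizer_iff]
    refine ⟨fun h k hk => h k ?_, fun h k hk => h k ?_⟩
    · simpa only [SetLike.mem_coe, MonoidHom.mem_ker] using hk
    · simpa only [SetLike.mem_coe, MonoidHom.mem_ker] using hk
  have h₁C : h₁ ∈ C := memC.2 hh₁
  have h₂C : h₂ ∈ C := memC.2 hh₂
  -- the conjugates `u m := h₂^m h₁ h₂^{-m}`; the cocycle `u m * h₁⁻¹` lies in the finite set `Z`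
  set Z : Set A := {z : A | c z = 1 ∧ ∀ k : A, c k = 1 → k * z = z * k} with hZdef
  let u : ℕ → A := fun m => h₂ ^ m * h₁ * (h₂ ^ m)⁻¹
  have hu : ∀ m, u m * h₁⁻¹ ∈ Z := by
    intro m
    refine ⟨?_, ?_⟩
    · show c (h₂ ^ m * h₁ * (h₂ ^ m)⁻¹ * h₁⁻¹) = 1
      simp only [map_mul, map_inv, map_pow]
      rw [mul_inv_eq_one, mul_inv_eq_iff_eq_mul, mul_comm]
    · have hm : u m * h₁⁻¹ ∈ C :=
        C.mul_mem (C.mul_mem (C.mul_mem (C.pow_mem h₂C m) h₁C) (C.inv_mem (C.pow_mem h₂C m))) (C.inv_mem h₁C)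
      exact memC.1 hm
  -- pigeonhole: two conjugates coincide
  haveI : Finite Z := hZ.to_subtype
  obtain ⟨m, m', hne, heq⟩ := Finite.exists_ne_map_eq_of_infinite (fun m : ℕ => (⟨u m * h₁⁻¹, hu m⟩ : Z))
  have heq' : u m = u m' := by
    have h1 : u m * h₁⁻¹ = u m' * h₁⁻¹ := congrArg Subtype.val heq
    exact mul_right_cancel h1
  -- from `u m = u (m + d + 1)` (either order) extract `M = d + 1`
  have key : ∀ {p q : ℕ}, p < q → u p = u q → ∃ M : ℕ, 1 ≤ M ∧ h₂ ^ M * h₁ = h₁ * h₂ ^ M := by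
    intro p q hpq hupq
    obtain ⟨d, rfl⟩ := Nat.exists_eq_add_of_lt hpq
    refine ⟨d + 1, Nat.le_add_left 1 d, ?_⟩
    have e1 : h₂ ^ (p + d + 1) = h₂ ^ p * h₂ ^ (d + 1) := by rw [add_assoc, pow_add]
    have e2 : h₂ ^ p * h₁ * (h₂ ^ p)⁻¹ = h₂ ^ p * h₂ ^ (d + 1) * h₁ * (h₂ ^ p * h₂ ^ (d + 1))⁻¹ := by
      have := hupq
      simp only [u] at this
      rw [e1] at this
      exact this
    have e3 : h₂ ^ (d + 1) * h₁ * (h₂ ^ (d + 1))⁻¹ = h₁ := by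
      calc h₂ ^ (d + 1) * h₁ * (h₂ ^ (d + 1))⁻¹
          = (h₂ ^ p)⁻¹ * (h₂ ^ p * h₂ ^ (d + 1) * h₁ * (h₂ ^ p * h₂ ^ (d + 1))⁻¹) * h₂ ^ p := by group
        _ = (h₂ ^ p)⁻¹ * (h₂ ^ p * h₁ * (h₂ ^ p)⁻¹) * h₂ ^ p := by rw [← e2]
        _ = h₁ := by group
    exact mul_inv_eq_iff_eq_mul.1 e3
  rcases lt_or_gt_of_ne hne with h | h
  · exact key h heq'
  · exact key h heq'.symm

/-! ## §2 An FC element of non-trivial character from (VI) + (ZF) -/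

/-- `det` is bilinear: `det(n•u, m•v) = n m det(u, v)`. [folklore] -/
theorem det2_smul_smul (n m : ℤ) (u v : Site 2) : MaxArea.det2 (n • u) (m • v) = n * m * MaxArea.det2 u v := by
  unfold MaxArea.det2
  simp only [Pi.smul_apply, smul_eq_mul]
  ring

/-- **FC WITNESS from a virtually inner twist and a finite-centre kernel.**  `c : A →* ℤ²` (written multiplicatively); `a, b` a rank-two pair; for each of `a, b`
some power times a kernel element centralises the kernel (VI); the centre of the kernel is finite (ZF).  Then some `h` with `c h ≠ 1` commutes with a finite-index
subgroup of `A`.  Proof: §1 gives commuting `h₁, h₂^M`; `N :=` the kernel of `A → ℤ² → (ℤ/D)²`, `D = det(c h₁, c h₂^M) ≠ 0`, has finite index and lies in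
`K · ⟨h₁, h₂^M⟩ ⊆ C(h₁)` by Cramer. [folklore] -/
theorem exists_fcWitness_of_virtuallyInner {A : Type} [Group A] (c : A →* Multiplicative (Site 2))
    (hZ : Set.Finite {z : A | c z = 1 ∧ ∀ k : A, c k = 1 → k * z = z * k})
    {a b : A} (hab : MaxArea.det2 (Multiplicative.toAdd (c a)) (Multiplicative.toAdd (c b)) ≠ 0)
    (ha : ∃ n : ℕ, 1 ≤ n ∧ ∃ k : A, c k = 1 ∧ ∀ k' : A, c k' = 1 → k' * (a ^ n * k⁻¹) = a ^ n * k⁻¹ * k')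
    (hb : ∃ n : ℕ, 1 ≤ n ∧ ∃ k : A, c k = 1 ∧ ∀ k' : A, c k' = 1 → k' * (b ^ n * k⁻¹) = b ^ n * k⁻¹ * k') :
    ∃ (h : A) (N : Subgroup A), c h ≠ 1 ∧ N.FiniteIndex ∧ ∀ n ∈ N, n * h = h * n := by
  obtain ⟨n₁, hn₁, k₁, hk₁, hh₁⟩ := ha
  obtain ⟨n₂, hn₂, k₂, hk₂, hh₂⟩ := hb
  set h₁ : A := a ^ n₁ * k₁⁻¹ with hh₁def
  set h₂ : A := b ^ n₂ * k₂⁻¹ with hh₂def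
  obtain ⟨M, hM, hcomm⟩ := exists_pow_commute_of_finite_center c hZ hh₁ hh₂
  -- the additive images of the two lifts
  have hc₁ : Multiplicative.toAdd (c h₁) = (n₁ : ℤ) • Multiplicative.toAdd (c a) := by
    rw [hh₁def, map_mul, map_inv, hk₁, inv_one, mul_one, map_pow, toAdd_pow, natCast_zsmul]
  have hc₂' : Multiplicative.toAdd (c h₂) = (n₂ : ℤ) • Multiplicative.toAdd (c b) := by
    rw [hh₂def, map_mul, map_inv, hk₂, inv_one, mul_one, map_pow, toAdd_pow, natCast_zsmul]
  have hc₂ : Multiplicative.toAdd (c (h₂ ^ M)) = ((M : ℤ) * n₂) • Multiplicative.toAdd (c b) := by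
    rw [map_pow, toAdd_pow, ← natCast_zsmul, hc₂', smul_smul]
  -- the two character values `u = c h₁`, `v = c h₂^M` and their determinant `D ≠ 0`
  obtain ⟨u, hudef⟩ : ∃ u : Site 2, Multiplicative.toAdd (c h₁) = u := ⟨_, rfl⟩
  obtain ⟨v, hvdef⟩ : ∃ v : Site 2, Multiplicative.toAdd (c (h₂ ^ M)) = v := ⟨_, rfl⟩
  have hD : MaxArea.det2 u v ≠ 0 := by
    rw [← hudef, ← hvdef, hc₁, hc₂, det2_smul_smul]
    refine mul_ne_zero (mul_ne_zero ?_ (mul_ne_zero ?_ ?_)) hab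
    · exact_mod_cast Nat.one_le_iff_ne_zero.1 hn₁
    · exact_mod_cast Nat.one_le_iff_ne_zero.1 hM
    · exact_mod_cast Nat.one_le_iff_ne_zero.1 hn₂
  obtain ⟨D, hDdef⟩ : ∃ D : ℤ, MaxArea.det2 u v = D := ⟨_, rfl⟩
  rw [hDdef] at hD
  obtain ⟨m, hmdef⟩ : ∃ m : ℕ, D.natAbs = m := ⟨_, rfl⟩
  haveI : NeZero m := ⟨by rw [← hmdef]; exact Int.natAbs_ne_zero.2 hD⟩
  -- reduction of the character modulo `m = |D|`
  let red : Multiplicative (Site 2) →* Multiplicative (Fin 2 → ZMod m) :=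
    AddMonoidHom.toMultiplicative ((Int.castAddHom (ZMod m)).compLeft (Fin 2))
  let f : A →* Multiplicative (Fin 2 → ZMod m) := red.comp c
  have hf : ∀ x : A, f x = 1 → ∀ i, D ∣ Multiplicative.toAdd (c x) i := by
    intro x hx i
    have h1 : ((Int.castAddHom (ZMod m)).compLeft (Fin 2)) (Multiplicative.toAdd (c x)) = 0 := by
      have := congrArg Multiplicative.toAdd hx
      simpa [f, red, AddMonoidHom.toMultiplicative] using this
    have h2 : ((Multiplicative.toAdd (c x) i : ℤ) : ZMod m) = 0 := by
      have := congrFun h1 i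
      simpa [AddMonoidHom.compLeft] using this
    have h3 : (m : ℤ) ∣ Multiplicative.toAdd (c x) i := (ZMod.intCast_zmod_eq_zero_iff_dvd _ m).1 h2
    rw [← hmdef] at h3
    exact Int.natAbs_dvd.1 h3
  refine ⟨h₁, f.ker, ?_, inferInstance, ?_⟩
  · -- `c h₁ ≠ 1`: its additive image is `n₁ • c a` with `c a ≠ 0` (rank) and `n₁ ≠ 0`
    intro h0
    apply hD
    have hu0 : u = 0 := by rw [← hudef, h0]; rfl
    rw [← hDdef, hu0]
    unfold MaxArea.det2
    simp
  · intro n hn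
    rw [MonoidHom.mem_ker] at hn
    have hdvd := hf n hn
    choose y hy using hdvd
    -- Cramer: `D • y = det(y, v) • u + det(u, y) • v`, so `c n = i₀ • u + j₀ • v`
    set i₀ : ℤ := MaxArea.det2 (fun i => y i) v with hi₀
    set j₀ : ℤ := MaxArea.det2 u (fun i => y i) with hj₀
    have hcn : Multiplicative.toAdd (c n) = i₀ • u + j₀ • v := by
      funext i
      rw [hy i, Pi.add_apply, Pi.smul_apply, Pi.smul_apply, smul_eq_mul, smul_eq_mul]
      have hcr := MaxArea.cramer u v (fun i => y i) i
      rw [hDdef] at hcr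
      exact hcr
    -- the element `g = h₁^{i₀} (h₂^M)^{j₀}` with the same character, and the kernel element `k = n g⁻¹`
    set g : A := h₁ ^ i₀ * (h₂ ^ M) ^ j₀ with hgdef
    have hcg : Multiplicative.toAdd (c g) = i₀ • u + j₀ • v := by
      rw [hgdef, map_mul, map_zpow, map_zpow, toAdd_mul, toAdd_zpow, toAdd_zpow, hudef, hvdef]
    have hk : c (n * g⁻¹) = 1 := by
      rw [map_mul, map_inv]
      have : c n = c g := Multiplicative.toAdd.injective (hcn.trans hcg.symm)
      rw [this, mul_inv_cancel]
    -- `g` commutes with `h₁`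
    have hcommM : Commute (h₂ ^ M) h₁ := hcomm
    have hg : g * h₁ = h₁ * g := by
      have c1 : Commute (h₁ ^ i₀) h₁ := (Commute.refl h₁).zpow_left i₀
      have c2 : Commute ((h₂ ^ M) ^ j₀) h₁ := hcommM.zpow_left j₀
      rw [hgdef]
      exact (c1.mul_left c2).eq
    -- assemble: `n = (n g⁻¹) g`
    calc n * h₁ = (n * g⁻¹) * (g * h₁) := by group
      _ = (n * g⁻¹) * (h₁ * g) := by rw [hg]
      _ = ((n * g⁻¹) * h₁) * g := (mul_assoc _ _ _).symm
      _ = (h₁ * (n * g⁻¹)) * g := by rw [hh₁ _ hk]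
      _ = h₁ * n := by group

/-! ## §3 The end state for orbit data with a virtually inner twist and a finite-centre kernel -/

/-- **END-STATE CONTINUITY, VIRTUALLY-INNER / FINITE-CENTRE CLASS (unconditional).**  On a connected locally finite graph `G`, let `A₀ ≤ Aut(G)` have finitely many
orbits and a character `c : A₀ →* ℤ²` of rank two killing every element that fixes a vertex.  Assume (VI) every `a ∈ A₀` has a power `aⁿ`, `n ≥ 1`, and a kernel
element `k` with `aⁿ k⁻¹` commuting with the whole kernel of `c`, and (ZF) the kernel elements commuting with the whole kernel form a finite set.  Then
`θ_x(p_c(G)) = 0` at EVERY vertex `x` — §2 supplies the FC element, «AutEndStateFC» `conj4_of_orbitDatum_fc` (covering route) concludes.  No growth hypothesis,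
no named fact.  builds on p205010 (kernel theorem, internal audit signed; external expert review pending).
[cite: BenjaminiSchramm1996, Conj. 4; §2 (almost transitive graphs)] [cite: MartineauSevero2019, Cor. 2.2] [cite: Hutchcroft2016, Thm. 1.1] -/
theorem conj4_of_orbitDatum_virtuallyInner {W : Type} (G : SimpleGraph W) [G.LocallyFinite] (hc : G.Connected)
    (A₀ : Subgroup (G ≃g G)) (reps : Finset W) (c : A₀ →* Multiplicative (Site 2))
    (horb : ∀ w : W, ∃ a : A₀, ∃ s ∈ reps, (a : G ≃g G) s = w) (hstab : ∀ (a : A₀) (w : W), (a : G ≃g G) w = w → c a = 1)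
    (hrank : ∃ a b : A₀, MaxArea.det2 (Multiplicative.toAdd (c a)) (Multiplicative.toAdd (c b)) ≠ 0)
    (hinn : ∀ a : A₀, ∃ n : ℕ, 1 ≤ n ∧ ∃ k : A₀, c k = 1 ∧ ∀ k' : A₀, c k' = 1 → k' * (a ^ n * k⁻¹) = a ^ n * k⁻¹ * k')
    (hZ : Set.Finite {z : A₀ | c z = 1 ∧ ∀ k : A₀, c k = 1 → k * z = z * k})
    (x : W) : theta G x (criticalProbIOf G x) = 0 := by
  obtain ⟨a, b, hab⟩ := hrank
  obtain ⟨h, N, hh, hN, hNh⟩ := exists_fcWitness_of_virtuallyInner c hZ hab (hinn a) (hinn b)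
  haveI : N.FiniteIndex := hN
  exact conj4_of_orbitDatum_fc G hc A₀ reps c horb hstab ⟨a, b, hab⟩ h hh N hNh x

/-- **CENTRELESS-KERNEL FORM**: (VI) + the kernel of `c` has TRIVIAL centre (every kernel element commuting with the whole kernel is `1`) ⟹ `θ_x(p_c) = 0`
everywhere.  builds on p205010 (kernel theorem, internal audit signed; external expert review pending).
[cite: BenjaminiSchramm1996, Conj. 4; §2 (almost transitive graphs)] [cite: MartineauSevero2019, Cor. 2.2] -/
theorem conj4_of_orbitDatum_virtuallyInner_centerless {W : Type} (G : SimpleGraph W) [G.LocallyFinite] (hc : G.Connected)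
    (A₀ : Subgroup (G ≃g G)) (reps : Finset W) (c : A₀ →* Multiplicative (Site 2))
    (horb : ∀ w : W, ∃ a : A₀, ∃ s ∈ reps, (a : G ≃g G) s = w) (hstab : ∀ (a : A₀) (w : W), (a : G ≃g G) w = w → c a = 1)
    (hrank : ∃ a b : A₀, MaxArea.det2 (Multiplicative.toAdd (c a)) (Multiplicative.toAdd (c b)) ≠ 0)
    (hinn : ∀ a : A₀, ∃ n : ℕ, 1 ≤ n ∧ ∃ k : A₀, c k = 1 ∧ ∀ k' : A₀, c k' = 1 → k' * (a ^ n * k⁻¹) = a ^ n * k⁻¹ * k')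
    (hZ1 : ∀ z : A₀, c z = 1 → (∀ k : A₀, c k = 1 → k * z = z * k) → z = 1)
    (x : W) : theta G x (criticalProbIOf G x) = 0 := by
  refine conj4_of_orbitDatum_virtuallyInner G hc A₀ reps c horb hstab hrank hinn ?_ x
  refine (Set.finite_singleton (1 : A₀)).subset ?_
  rintro z ⟨hz1, hz2⟩
  exact hZ1 z hz1 hz2

/-! ## §4 The virtually split structure behind the test (refuter's located item W-Outer-1, typed; gen 33 append) -/

/-- **(VI) + (ZF) + rank two ⟹ VIRTUALLY SPLIT.**  Under the hypotheses of `exists_fcWitness_of_virtuallyInner` there are `h₁, h₂ ∈ A` with INDEPENDENT characters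
(`det(c h₁, c h₂) ≠ 0`) which COMMUTE and both centralise the kernel `K = ker c`, together with a finite-index subgroup `N ≤ A` every element of which is
`k · h₁^i · h₂^j` with `k ∈ K` — i.e. `K · ⟨h₁, h₂⟩ ⊇ N` is an internal direct product `K × ℤ²` of finite index: the structure the test of §2 detects (the words
of record carried it as a remark; this makes it a theorem).  Proof = §1 (commuting corrected lifts) + the Cramer step of §2. [folklore] -/
theorem exists_commuting_centralPair_of_virtuallyInner {A : Type} [Group A] (c : A →* Multiplicative (Site 2))
    (hZ : Set.Finite {z : A | c z = 1 ∧ ∀ k : A, c k = 1 → k * z = z * k})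
    {a b : A} (hab : MaxArea.det2 (Multiplicative.toAdd (c a)) (Multiplicative.toAdd (c b)) ≠ 0)
    (ha : ∃ n : ℕ, 1 ≤ n ∧ ∃ k : A, c k = 1 ∧ ∀ k' : A, c k' = 1 → k' * (a ^ n * k⁻¹) = a ^ n * k⁻¹ * k')
    (hb : ∃ n : ℕ, 1 ≤ n ∧ ∃ k : A, c k = 1 ∧ ∀ k' : A, c k' = 1 → k' * (b ^ n * k⁻¹) = b ^ n * k⁻¹ * k') :
    ∃ (h₁ h₂ : A) (N : Subgroup A), N.FiniteIndex ∧
      MaxArea.det2 (Multiplicative.toAdd (c h₁)) (Multiplicative.toAdd (c h₂)) ≠ 0 ∧ h₂ * h₁ = h₁ * h₂ ∧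
      (∀ k : A, c k = 1 → k * h₁ = h₁ * k) ∧ (∀ k : A, c k = 1 → k * h₂ = h₂ * k) ∧
      (∀ n ∈ N, ∃ (k : A) (i j : ℤ), c k = 1 ∧ n = k * (h₁ ^ i * h₂ ^ j)) := by
  obtain ⟨n₁, hn₁, k₁, hk₁, hh₁⟩ := ha
  obtain ⟨n₂, hn₂, k₂, hk₂, hh₂⟩ := hb
  set h₁ : A := a ^ n₁ * k₁⁻¹ with hh₁def
  set h₂ : A := b ^ n₂ * k₂⁻¹ with hh₂def
  obtain ⟨M, hM, hcomm⟩ := exists_pow_commute_of_finite_center c hZ hh₁ hh₂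
  have hc₁ : Multiplicative.toAdd (c h₁) = (n₁ : ℤ) • Multiplicative.toAdd (c a) := by
    rw [hh₁def, map_mul, map_inv, hk₁, inv_one, mul_one, map_pow, toAdd_pow, natCast_zsmul]
  have hc₂' : Multiplicative.toAdd (c h₂) = (n₂ : ℤ) • Multiplicative.toAdd (c b) := by
    rw [hh₂def, map_mul, map_inv, hk₂, inv_one, mul_one, map_pow, toAdd_pow, natCast_zsmul]
  have hc₂ : Multiplicative.toAdd (c (h₂ ^ M)) = ((M : ℤ) * n₂) • Multiplicative.toAdd (c b) := by
    rw [map_pow, toAdd_pow, ← natCast_zsmul, hc₂', smul_smul]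
  obtain ⟨u, hudef⟩ : ∃ u : Site 2, Multiplicative.toAdd (c h₁) = u := ⟨_, rfl⟩
  obtain ⟨v, hvdef⟩ : ∃ v : Site 2, Multiplicative.toAdd (c (h₂ ^ M)) = v := ⟨_, rfl⟩
  have hD : MaxArea.det2 u v ≠ 0 := by
    rw [← hudef, ← hvdef, hc₁, hc₂, det2_smul_smul]
    refine mul_ne_zero (mul_ne_zero ?_ (mul_ne_zero ?_ ?_)) hab
    · exact_mod_cast Nat.one_le_iff_ne_zero.1 hn₁
    · exact_mod_cast Nat.one_le_iff_ne_zero.1 hM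
    · exact_mod_cast Nat.one_le_iff_ne_zero.1 hn₂
  obtain ⟨D, hDdef⟩ : ∃ D : ℤ, MaxArea.det2 u v = D := ⟨_, rfl⟩
  rw [hDdef] at hD
  obtain ⟨m, hmdef⟩ : ∃ m : ℕ, D.natAbs = m := ⟨_, rfl⟩
  haveI : NeZero m := ⟨by rw [← hmdef]; exact Int.natAbs_ne_zero.2 hD⟩
  let red : Multiplicative (Site 2) →* Multiplicative (Fin 2 → ZMod m) :=
    AddMonoidHom.toMultiplicative ((Int.castAddHom (ZMod m)).compLeft (Fin 2))
  let f : A →* Multiplicative (Fin 2 → ZMod m) := red.comp c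
  have hf : ∀ x : A, f x = 1 → ∀ i, D ∣ Multiplicative.toAdd (c x) i := by
    intro x hx i
    have h1 : ((Int.castAddHom (ZMod m)).compLeft (Fin 2)) (Multiplicative.toAdd (c x)) = 0 := by
      have := congrArg Multiplicative.toAdd hx
      simpa [f, red, AddMonoidHom.toMultiplicative] using this
    have h2 : ((Multiplicative.toAdd (c x) i : ℤ) : ZMod m) = 0 := by
      have := congrFun h1 i
      simpa [AddMonoidHom.compLeft] using this
    have h3 : (m : ℤ) ∣ Multiplicative.toAdd (c x) i := (ZMod.intCast_zmod_eq_zero_iff_dvd _ m).1 h2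
    rw [← hmdef] at h3
    exact Int.natAbs_dvd.1 h3
  have hcen₂ : ∀ k : A, c k = 1 → k * h₂ ^ M = h₂ ^ M * k := fun k hk => ((Commute.symm (hh₂ k hk)).pow_left M).symm.eq
  refine ⟨h₁, h₂ ^ M, f.ker, inferInstance, ?_, hcomm, hh₁, hcen₂, ?_⟩
  · rw [hudef, hvdef, hDdef]; exact hD
  · intro n hn
    rw [MonoidHom.mem_ker] at hn
    have hdvd := hf n hn
    choose y hy using hdvd
    set i₀ : ℤ := MaxArea.det2 (fun i => y i) v with hi₀
    set j₀ : ℤ := MaxArea.det2 u (fun i => y i) with hj₀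
    have hcn : Multiplicative.toAdd (c n) = i₀ • u + j₀ • v := by
      funext i
      rw [hy i, Pi.add_apply, Pi.smul_apply, Pi.smul_apply, smul_eq_mul, smul_eq_mul]
      have hcr := MaxArea.cramer u v (fun i => y i) i
      rw [hDdef] at hcr
      exact hcr
    set g : A := h₁ ^ i₀ * (h₂ ^ M) ^ j₀ with hgdef
    have hcg : Multiplicative.toAdd (c g) = i₀ • u + j₀ • v := by
      rw [hgdef, map_mul, map_zpow, map_zpow, toAdd_mul, toAdd_zpow, toAdd_zpow, hudef, hvdef]
    have hk : c (n * g⁻¹) = 1 := by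
      rw [map_mul, map_inv]
      have : c n = c g := Multiplicative.toAdd.injective (hcn.trans hcg.symm)
      rw [this, mul_inv_cancel]
    refine ⟨n * g⁻¹, i₀, j₀, hk, ?_⟩
    rw [hgdef]; group

end AutCyl

end Summit.CriticalPhenomena.PercolationContinuityZ3.Theorems.Transplant

end
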